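import Literature.IUT.HodgeTheaters.LocalFrobenioidsArchHolPairs
import Literature.IUT.HodgeTheaters.FPrimeStripsModelBijectiveOfHolPairRigidity
import Mathlib.CategoryTheory.InducedCategory
import HarnessLib

/-!
# [IUTchI] Def 5.2 (i) (b) at `v ∈ 𝕍^arc`: a CANDIDATE ambient category of archimedean collections of data
# `(‡𝒞_v, ‡𝒟_v, ‡κ_v)` presented over the [AbsTopIII] §4 interface, at the resolution of [AbsTopIII] Rmk 4.1.1, and
# [IUTchI] Cor 5.3 (ii)'s archimedean model case there — UNCONDITIONAL (row «C53ii/A3 EX34-ARCH-SLOT»)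

S. Mochizuki, *Inter-universal Teichmüller theory I*, kurims manuscript (May 2020), Def 5.2 (i) (b) p. 134: «if
`v ∈ 𝕍^arc`, then `‡ℱ_v = (‡𝒞_v, ‡𝒟_v, ‡κ_v)` is a collection of data consisting of a category, an Aut-holomorphic
orbispace, and a Kummer structure such that there exists an isomorphism of collections of data `‡ℱ_v ⥲ ℱ_v`»;
Cor 5.3 (ii) p. 144 and its proof l. 36–39 «follows immediately from … [AbsTopIII], Proposition 4.2, (i) [cf. also
[AbsTopIII], Remarks 3.1.1, 4.1.1; the discussion of Definition 5.2, (vi), (viii)]» ([IUTchI] Cor 5.3 (ii) p.144)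
[claim: Mochizuki2012, status: disputed]; S. Mochizuki, *Topics in absolute anabelian geometry III*, Rmk 4.1.1
p. 105 «The topological monoid "`𝒪^⊳_k`" associated to a CAF `k` [cf. Definition 4.1, (i)] is essentially the
data used to construct the archimedean Frobenioids of [Mzk17], Example 3.3, (ii)» ([Mzk17] = [FrdII] in this
tree's cite convention), Prop 4.2 (i) statement p. 105, proof p. 106 («follows immediately from the required
compatibility of morphisms of `𝒞^hol_T` with the Kummer structures») [cite: MochizukiAbsTopIII2015,
Remark 4.1.1 p.105].

WHAT THIS FILE DOES (abc-iut cell, sequel to rows «C53ii/A1» `FPrimeStripsModelBijectiveOfHolPairRigidity.lean`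
(p491595) and «C53ii/A2» `LocalFrobenioidsArchHolPairs.lean`; definitions + proofs, no `instance` declared — the
category structure is Mathlib's `InducedCategory` —, no notation, no named `Prop` fact).  abc-iut-L5-t4's `FKit`
leaves the archimedean ambient category `FAmb v` an opaque slot.  Here is a CONCRETE CANDIDATE for it at the
resolution the L5 interface `ArchLocalFrobenioid` affords: objects = presented Ex 3.4 data `(X, π)` over `𝔄` with
completion `K_v` (`ArchFData`); morphisms = morphisms of the underlying Aut-holomorphic `TM`-pairs
`(‡𝒟_v ↶ 𝒪^⊳(‡𝒞_v))` (Rmk 4.1.1: «essentially the data»; `ArchFSlot := InducedCategory 𝒞^hol_TM toTM`), so that the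
ISOMORPHISMS of the slot are exactly the isomorphisms of presented data of row A2 (`isoEquivHolIso`: `HolIso`, the
Rmk 3.5.2-stipulated portion).  PROVED: at this slot hypothesis (R) of p491595 holds (`toTM_mapIso_bijective`, the
induced functor is fully faithful) and hence the ARCHIMEDEAN MODEL CASE of Cor 5.3 (ii) with base `EA` holds
OUTRIGHT for every pair of objects — `toEA_mapIso_bijective`: `Isom(‡ℱ¹_v, ‡ℱ²_v) → Isom_EA(‡𝒟¹_v, ‡𝒟²_v)` bijective,
the map being `φ ↦ φ_𝒟` (`toEA_mapIso_eq_base`) and the middle step [AbsTopIII] Prop 4.2 (i) BY NAME; in `FKit`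
currency (`PMBaseKit.FKit.model_bijective_of_archFSlot`, `…_of_archFSlot'`): for any kit whose archimedean slot is
presented fully faithfully in `ArchFSlot` and whose base functor is `… → EA → Amb v` with `EA → Amb v` fully faithful
(resp. bijective on the isomorphisms concerned), the hypothesis `h v` of `isomFtoDBijective_of_model` holds — the
only remaining input being the genuine base slot (E).  Non-vacuity: `ArchFData.nonempty_of`.

HONEST LIMITS.  This slot sees `‡𝒞_v` only through `𝒪^⊳(‡𝒞_v)` (the L5 interface stipulates no relation between the
fields `Cv` and `OC`; the category rides along as a decoration of the object and does not enter morphisms) — i.e.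
(R) holds here BY CONSTRUCTION, which is exactly the statement that the Frobenioid-level refinement of print
(morphisms = isomorphism classes of equivalences `‡𝒞¹_v ⥲ ‡𝒞²_v` compatible with the Kummer structures through
`𝒪^⊳(−)` of [FrdI] Thm 3.4 (iii), and their rigidity/lifting for THE archimedean Frobenioid of [FrdII] Ex 3.3) is
NOT performed here: it is layer L1's and would replace `ArchFSlot` by a slot mapping to it.  MODEL level over a
named interface.  Nothing here bears on [IUTchIII] Cor. 3.12 or takes a side; nothing asserts abc proved or
refuted; typed ≠ proved except where proved.
-/

noncomputable section

namespace Literature.IUT.HodgeTheaters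

open CategoryTheory
open Literature.AnabelianGeometry.AbsoluteAnabelian

universe u w

variable (𝔄 : AutHolFieldFunctor.{u}) (Kv : Type u) [NormedField Kv] [NormedAlgebra ℝ Kv]

/-- **A presented archimedean collection of data** `‡ℱ_v = (‡𝒞_v, ‡𝒟_v, ‡κ_v)` with completion `K_v`: an Ex 3.4 (i)
datum of abc-iut-L5-t2's interface together with its reading through `𝔄` (row A2's `HolPresentation`: `‡𝒟_v` an
object of `EA`, `𝒜_{‡𝒟_v} ≅ 𝒜_D`). ([IUTchI] Def 5.2 (i) p.134) [claim: Mochizuki2012, status: disputed] -/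
structure ArchFData : Type (u + 1) where
  /-- the Ex 3.4 (i) datum `(‡𝒞_v, 𝒪^⊳(‡𝒞_v), 𝒜, ‡κ_v, …)` -/
  X : ArchLocalFrobenioid.{u} Kv
  /-- its reading through the [AbsTopIII] Cor 2.7 (e) interface -/
  π : X.HolPresentation 𝔄

namespace ArchFData

variable {𝔄 Kv}

/-- The underlying Aut-holomorphic `TM`-pair `(‡𝒟_v ↶ 𝒪^⊳_{K_v})` (row A2's `tmPair`; Rmk 4.1.1).
[cite: MochizukiAbsTopIII2015, Remark 4.1.1 p.105] -/
def toTM (F : ArchFData 𝔄 Kv) : HolMonoidPair 𝔄 .TM := F.π.tmPair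

/-- The structure-orbispace of the underlying pair is `‡𝒟_v`. ([IUTchI] Def 5.2 (i) p.134) [claim: Mochizuki2012, status: disputed] -/
@[simp] theorem toTM_X (F : ArchFData 𝔄 Kv) : F.toTM.X = F.π.D := rfl

/-- Non-vacuity: every Ex 3.4 datum and every object of `EA` give a presented datum (row A2's
`nonempty_holPresentation`). ([IUTchI] Def 5.2 (i) p.134) [claim: Mochizuki2012, status: disputed] -/
theorem nonempty_of (X : ArchLocalFrobenioid.{u} Kv) (D : 𝔄.EA) : Nonempty (ArchFData 𝔄 Kv) := by
  obtain ⟨π⟩ := ArchLocalFrobenioid.nonempty_holPresentation 𝔄 X D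
  exact ⟨⟨X, π⟩⟩

end ArchFData

/-- **The candidate archimedean slot category** at the resolution of Rmk 4.1.1: presented data `(‡𝒞_v, ‡𝒟_v, ‡κ_v)`,
with morphisms the morphisms of the underlying Aut-holomorphic `TM`-pairs (Mathlib's `InducedCategory` along
`ArchFData.toTM`; no instance is declared here).  Its isomorphisms are the isomorphisms of presented data of row A2
(`ArchFSlot.isoEquivHolIso`). ([IUTchI] Def 5.2 (i) p.134) [claim: Mochizuki2012, status: disputed] -/
abbrev ArchFSlot : Type (u + 1) :=
  InducedCategory (HolMonoidPair 𝔄 .TM) (ArchFData.toTM (𝔄 := 𝔄) (Kv := Kv))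

namespace ArchFSlot

variable {𝔄 Kv}

/-- The Ex 3.4 datum of an object of the slot. ([IUTchI] Def 5.2 (i) p.134) [claim: Mochizuki2012, status: disputed] -/
abbrev X (F : ArchFSlot 𝔄 Kv) : ArchLocalFrobenioid.{u} Kv := ArchFData.X F

/-- The presentation over `𝔄` of an object of the slot. ([IUTchI] Def 5.2 (i) p.134) [claim: Mochizuki2012, status: disputed] -/
abbrev π (F : ArchFSlot 𝔄 Kv) : (X F).HolPresentation 𝔄 := ArchFData.π F

variable (𝔄 Kv) in
/-- «`‡ℱ_v ↦ (‡𝒟_v ↶ 𝒪^⊳(‡𝒞_v))`»: the (fully faithful) functor to `𝒞^hol_TM` (the presentation functor `ι` of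
p491595 at this slot). [cite: MochizukiAbsTopIII2015, Remark 4.1.1 p.105] -/
abbrev toTM : ArchFSlot 𝔄 Kv ⥤ HolMonoidPair 𝔄 .TM := inducedFunctor _

variable (𝔄 Kv) in
/-- **Rmk 5.2.1 (i) «`ℱ_v ↦ 𝒟_v`» at the slot**: `‡ℱ_v ↦ ‡𝒟_v ∈ Ob(EA)`, the composite with [AbsTopIII] Def 4.1 (iii)'s
`(𝕏 ↶ M) ↦ 𝕏`. ([IUTchI] Rmk 5.2.1 (i) p.143) [claim: Mochizuki2012, status: disputed] -/
abbrev toEA : ArchFSlot 𝔄 Kv ⥤ 𝔄.EA := inducedFunctor _ ⋙ HolMonoidPair.toEA 𝔄 .TM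

/-- `‡ℱ_v ↦ ‡𝒟_v` on objects. ([IUTchI] Rmk 5.2.1 (i) p.143) [claim: Mochizuki2012, status: disputed] -/
@[simp] theorem toEA_obj (F : ArchFSlot 𝔄 Kv) : (toEA 𝔄 Kv).obj F = (π F).D := rfl

/-- **Isomorphisms in the slot ARE the isomorphisms of presented data** of row A2 (`HolIso`: `φ_𝒟` of `EA` +
`φ_𝕄 : 𝒪^⊳(¹𝒞_v) ⥲ 𝒪^⊳(²𝒞_v)` bicontinuous + Kummer compatibility): through `𝒞^hol_TM` (`fullyFaithfulInducedFunctor`) and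
row A2's `HolIso.pairIsoEquiv`. ([IUTchI] Rmk 3.5.2 p.87) [claim: Mochizuki2012, status: disputed] -/
def isoEquivHolIso (F G : ArchFSlot 𝔄 Kv) : (F ≅ G) ≃ ArchLocalFrobenioid.HolIso (π F) (π G) :=
  ((fullyFaithfulInducedFunctor _).isoEquiv (X := F) (Y := G)).trans
    (ArchLocalFrobenioid.HolIso.pairIsoEquiv (π F) (π G)).symm

/-- Under `isoEquivHolIso`, `‡ℱ_v ↦ ‡𝒟_v` on isomorphisms is `φ ↦ φ_𝒟`. ([IUTchI] Rmk 5.2.1 (i) p.143)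
[claim: Mochizuki2012, status: disputed] -/
theorem toEA_mapIso_eq_base {F G : ArchFSlot 𝔄 Kv} (α : F ≅ G) :
    (toEA 𝔄 Kv).mapIso α = (isoEquivHolIso F G α).base := by
  have h : ArchLocalFrobenioid.HolIso.toPairIso (isoEquivHolIso F G α) = (toTM 𝔄 Kv).mapIso α :=
    (ArchLocalFrobenioid.HolIso.pairIsoEquiv (π F) (π G)).apply_symm_apply _
  rw [← ArchLocalFrobenioid.HolIso.toEA_mapIso_toPairIso, h]
  exact Iso.ext rfl

/-- **Hypothesis (R) of p491595 HOLDS at this slot**: `‡ℱ_v ↦ (‡𝒟_v ↶ 𝒪^⊳(‡𝒞_v))` is bijective on `Isom(‡ℱ¹_v, ‡ℱ²_v)`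
(fully faithful by construction — see the module docstring for what this does and does not say).
[cite: MochizukiAbsTopIII2015, Remark 4.1.1 p.105] -/
theorem toTM_mapIso_bijective (F G : ArchFSlot 𝔄 Kv) :
    Function.Bijective fun α : F ≅ G => (toTM 𝔄 Kv).mapIso α :=
  Cor53ii.mapIso_bijective_of_fullyFaithful (fullyFaithfulInducedFunctor _) F G

/-- **[IUTchI] Cor 5.3 (ii), ARCHIMEDEAN MODEL CASE, at this slot with base `EA` — UNCONDITIONAL**: for all objects
`‡ℱ¹_v, ‡ℱ²_v` the map `Isom(‡ℱ¹_v, ‡ℱ²_v) → Isom_EA(‡𝒟¹_v, ‡𝒟²_v)`, `α ↦ 𝒟(α)`, is bijective — (R) above followed by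
[AbsTopIII] Prop 4.2 (i) (`HolMonoidPair.mapIso_toEA_bijective`, BY NAME).
([IUTchI] Cor 5.3 (ii) p.144) [claim: Mochizuki2012, status: disputed] -/
theorem toEA_mapIso_bijective (F G : ArchFSlot 𝔄 Kv) :
    Function.Bijective fun α : F ≅ G => (toEA 𝔄 Kv).mapIso α :=
  Cor53ii.mapIso_bijective_comp (toTM 𝔄 Kv) (HolMonoidPair.toEA 𝔄 .TM) (toTM_mapIso_bijective F G)
    (HolMonoidPair.mapIso_toEA_bijective _ _)

/-- The same through any `E : EA ⥤ D` bijective on `Isom(‡𝒟¹_v, ‡𝒟²_v)` (the genuine base slot «isomorphs of `𝒟_v`»,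
hypothesis (E)). ([IUTchI] Cor 5.3 (ii) p.144) [claim: Mochizuki2012, status: disputed] -/
theorem toEA_comp_mapIso_bijective {D : Type*} [Category D] (E : 𝔄.EA ⥤ D) (F G : ArchFSlot 𝔄 Kv)
    (hE : Function.Bijective fun β : (π F).D ≅ (π G).D => E.mapIso β) :
    Function.Bijective fun α : F ≅ G => (toEA 𝔄 Kv ⋙ E).mapIso α :=
  Cor53ii.mapIso_bijective_comp (toEA 𝔄 Kv) E (toEA_mapIso_bijective F G) hE

end ArchFSlot

/-! ### `FKit` currency -/

namespace PMBaseKit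

namespace FKit

variable {𝔄 Kv}
variable {l : ℕ} {K : PMBaseKit.{w} l} {M : K.MultKit} {FK : K.FKit M}

/-- **The hypothesis `h v` of `isomFtoDBijective_of_model` at an archimedean slot realised in `ArchFSlot`**: if the
kit's ambient category `FAmb v` is presented FULLY FAITHFULLY in the candidate slot (`j`; e.g. `FAmb v` a full
subcategory of isomorphs of `ℱ_v`), and its base functor `toD v` is, up to natural isomorphism, `‡ℱ_v ↦ ‡𝒟_v` followed
by a fully faithful `E : EA ⥤ Amb v` (the genuine base slot), then `Isom(ℱ_v, ℱ_v) → Isom(𝒟_v, 𝒟_v)` is bijective —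
p491595's `model_bijective_of_fullyFaithful_presentation` with (R) discharged by `ArchFSlot`.
([IUTchI] Cor 5.3 (ii) p.144) [claim: Mochizuki2012, status: disputed] -/
theorem model_bijective_of_archFSlot (v : K.V) {j : FK.FAmb v ⥤ ArchFSlot 𝔄 Kv} (hj : j.FullyFaithful)
    {E : 𝔄.EA ⥤ K.Amb v} (hE : E.FullyFaithful) (e : (j ⋙ ArchFSlot.toEA 𝔄 Kv) ⋙ E ≅ FK.toD v) :
    Function.Bijective fun α : FK.fModel v ≅ FK.fModel v => (FK.toD v).mapIso α :=
  model_bijective_of_fullyFaithful_presentation v (hj.comp (fullyFaithfulInducedFunctor _)) hE e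

/-- The same with (E) weakened to «`E` bijective on `Isom(𝒟_v, 𝒟_v)`» at the model's structure-orbispace.
([IUTchI] Cor 5.3 (ii) p.144) [claim: Mochizuki2012, status: disputed] -/
theorem model_bijective_of_archFSlot' (v : K.V) {j : FK.FAmb v ⥤ ArchFSlot 𝔄 Kv} (hj : j.FullyFaithful)
    (E : 𝔄.EA ⥤ K.Amb v) (e : (j ⋙ ArchFSlot.toEA 𝔄 Kv) ⋙ E ≅ FK.toD v)
    (hE : Function.Bijective fun β : (ArchFSlot.π (j.obj (FK.fModel v))).D ≅
      (ArchFSlot.π (j.obj (FK.fModel v))).D => E.mapIso β) :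
    Function.Bijective fun α : FK.fModel v ≅ FK.fModel v => (FK.toD v).mapIso α :=
  Cor53ii.mapIso_bijective_congr e
    (Cor53ii.mapIso_bijective_comp (j ⋙ ArchFSlot.toEA 𝔄 Kv) E
      (Cor53ii.mapIso_bijective_comp j (ArchFSlot.toEA 𝔄 Kv)
        (Cor53ii.mapIso_bijective_of_fullyFaithful hj _ _) (ArchFSlot.toEA_mapIso_bijective _ _)) hE)

end FKit

end PMBaseKit

end Literature.IUT.HodgeTheaters

end
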